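import Summits.QuantumFields.YangMills.Theorems.BalabanUVNodesSpineReadingOfRecord13CoPHKComponentSizeBlocksSkeletonCond
import Literature.MathematicalPhysics.QuantumFieldTheory.Balaban1983to89.Node00.TwoRunSiteNear

/-!
# THE SKELETON FACES AT THE METRIC CLOSENESS `Node00.SupNear ϱ` — the closeness, its symmetry and its covering number `(2ϱ+1)^4` DISCHARGED: the N20 face at the skeleton dial
# from ONE-BLOCK CONDITIONAL letters whose environments are separated from the block by MORE THAN `ϱ K j` blocks in some coordinate (around the torus); the supplier's dials
# are a RADIUS `ϱ`, a skeleton size schedule `k` and a block level `lv` — nothing else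

Cell `pub-ymgap`, YM-PLAN Track A (HUMAN RULING D-0062; width push D-0149); seat `pub-ymgap-dag-n20-d` (R134 (a) N20 NE7b s3 = the U5d ∕ `crOfRecord₁₃` lineage, its declarer)
gen 34; companion of `…CoPHKComponentSizeBlocksSkeletonCond` (gen 34: `relWeightBound_card_of_condBlockLetters_geometric`, `…_of_condInsideBlockLetters_id{,_of_eq}`) and
`Node00/TwoRunSiteNear` (gen 34: `SupNear`, `supNear_refl`, `supNear_symm`, `exists_cover_supNear`).  `--kind proof --supports stmt-QuantumFields-27366 --as helper` (K3⁸);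
COUNT-NEUTRAL; THEOREMS ONLY (0 `def`).  [LF-II] = [Balaban1989LargeFieldII]; [III] = [Balaban1988Convergent].
WHY.  `…BlocksSkeleton{,Cond}` leave the closeness `Nr K j` abstract (reflexive, symmetric, covering number `m K j`).  Print's separation is metric — a large-field cube drags its
enlargement into the region ([LF-II] (1.76) p. 381, p. 384 `S(Z) = Z′^{∼10}`) — so the canonical choice is the sup-distance closeness `SupNear (ϱ K j)` on the level-`lv K j` block
torus with `m K j = (2·ϱ K j + 1)^4` (`Node00.exists_cover_supNear`).  This file pins it: ★★★ `relWeightBound_card_of_condBlockLetters_geometric_supNear` (any step-preserving dial,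
MEETS events), ★★★ `relWeightBound_card_of_condInsideBlockLetters_id_supNear` (`keyReadingId₁₃`, INSIDE events, `lv K j ≤ j`) and ★★★ `…_id_of_eq_supNear` (the 𝐃-cube grain).
After it the N20 size-reading face asks its supplier for exactly: a radius `ϱ K j`, a block level `lv K j` (`≤ j`, or `=` the cube grain), a skeleton threshold
`k K j ≥ ⌈log₂ |Site_{lv K j}|⌉ + K + j + 3`, and ONE-BLOCK CONDITIONAL letters `η K j` with `2·(81·(2ϱ+1)^8)²·η K j ≤ 1`, `η K j ≤ η₀ ≤ 1` — «given that `Z_j` contains the blocks of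
an environment every block of which is farther than `ϱ K j` from `b` in some coordinate, containing `b` as well costs at most `η K j` of that class weight», in both runs.
HONEST FRAMING.  [folklore] instantiation BY NAME; the one-block conditional letters are HYPOTHESES (inhabited for no family today; NOT PRINTED as statements about the RELATIVE (2.18)
class weights — (1.89) p. 387 is the sup-norm analogue for ONE domain; LCS-shaped); the enlargement radius of the layer calculus in `lv`-blocks is NOT computed here (`ϱ` free); NO
weight is bounded, NO estimate proved; nothing of Bałaban's asserted; NE7 ∕ NE7b ∕ NE7c NOT PRINTED for `d = 4` ∕ NOT proved; no `Provisos₁₃CoPH` inhabitant claimed (K0⁷ OPEN);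
K3⁸ v7 untouched; N19 ∕ N20 ∕ N21 ∕ N27 NOT discharged; counts UNMOVED (typed 28∕28 · discharged 8∕27); one finite four-torus programme at fixed `ε` — NOT ℝ⁴, NOT OS, NOT a mass
gap, NOT the Clay problem.  No `def`, no `instance`, no `notation`, no `sorry`; no decl below carries a cite tag.
-/

noncomputable section

open scoped BigOperators
open Finset

namespace YMDAG.UVSplit

open Literature.MathematicalPhysics.QuantumFieldTheory.Balaban1983to89
open Literature.MathematicalPhysics.QuantumFieldTheory.Balaban1983to89.T4Continuum
open Literature.MathematicalPhysics.QuantumFieldTheory.Balaban1983to89.Node00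
open Literature.MathematicalPhysics.QuantumFieldTheory.Balaban1983to89.B5Eq118OneStroke (iterBlockOf iterBlock)
open T4WeightBudget (RelWeightBound)

variable {F : T4Family} {N : ℕ} [NeZero N]

section Near

variable (θ : Stage13HParams F N) (hP : θ.Provisos₁₃CoPH F N) (K₀ : ℕ) (g₀ : ℕ → ℝ) (os : List (ULoop F))
  (kr : ℕ → (Σ K, SiteSeqKey F (K₀ + K)) → (Σ K, SiteSeqKey F (K₀ + K))) (jcut : ℕ → ℕ) (ϱ k lv : ℕ → ℕ → ℕ)

/-- The covering number of `SupNear (ϱ K j)` on the level-`lv K j` block torus of step `K` is `(2ϱ+1)^4` (`Node00.exists_cover_supNear` with `d = 4`). [bookkeeping] -/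
theorem exists_cover_supNear_four (K j : ℕ) (b : Site (F.P (K₀ + K)) (lv K j)) :
    ∃ s : Finset (Site (F.P (K₀ + K)) (lv K j)), s.card ≤ (2 * ϱ K j + 1) ^ 4 ∧ ∀ c, SupNear (ϱ K j) c b → c ∈ s := by
  have h := exists_cover_supNear (P := F.P (K₀ + K)) (j := lv K j) (ϱ K j) b
  rwa [T4Family.P_d] at h

/-- ★★★ **THE N20 FACE AT THE SKELETON DIAL, METRIC SEPARATION, ONE-BLOCK CONDITIONAL MEETS LETTERS** (any step-preserving dial `kr`; block levels `lv K j ≤ m + K₀ + K`):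
conditional letters `0 ≤ η K j ≤ η₀ ≤ 1` with `2·((2ϱ+1)^4·3^4·(2ϱ+1)^4)²·η K j ≤ 1` for environments `S` and blocks `b ∉ S` NOT `ϱ K j`-close to any block of `S`, in both runs, under
the skeleton schedule `k K j ≥ ⌈log₂ |Site_{lv K j}|⌉ + K + j + 3`, give `RelWeightBound` at the coarse carriers (component thresholds `(2ϱ+1)^4 · k · L^{4·lv}` finest sites) with
`W K := η₀ · 2^{−(K+1)}`. [bookkeeping] -/
theorem relWeightBound_card_of_condBlockLetters_geometric_supNear
    (hkr : ∀ (K : ℕ) (x : Σ K, SiteSeqKey F (K₀ + K)), x ∈ classSet₁₃ θ K₀ g₀ K → (kr K x).1 = K)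
    {η : ℕ → ℕ → ℝ} {η₀ : ℝ} (hη0 : ∀ K j, 0 ≤ η K j) (hη1 : ∀ K j, η K j ≤ η₀) (hη₀ : η₀ ≤ 1)
    (hD : ∀ K j, 2 * ((((2 * ϱ K j + 1) ^ 4 : ℕ) : ℝ) * 3 ^ 4 * ((2 * ϱ K j + 1) ^ 4 : ℕ)) ^ 2 * η K j ≤ 1)
    (hks : ∀ K j, Nat.clog 2 (Fintype.card (Site (F.P (K₀ + K)) (lv K j))) + K + j + 3 ≤ k K j) (hlv : ∀ K j, lv K j ≤ F.m + (K₀ + K))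
    (hCA : ∀ (K : ℕ) (t : ℝ), |t| ≤ 1 → ∀ j ∈ Finset.Icc 1 (jcut K), ∀ (S : Finset (Site (F.P (K₀ + K)) (lv K j))) (b : Site (F.P (K₀ + K)) (lv K j)),
      b ∉ S → (∀ s ∈ S, ¬ SupNear (ϱ K j) b s) →
      ∑ u ∈ badClassK₁₃ θ K₀ g₀ kr (fun _ u => ∀ y : SiteSeqKey F (K₀ + K), u = ⟨K, y⟩ →
          (↑(insert b S) : Set (Site (F.P (K₀ + K)) (lv K j))) ⊆ iterBlockOf (lv K j) '' (y.2 j)ᶜ) K t, weightAK₁₃ θ hP K₀ g₀ os kr K t u ≤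
        η K j * ∑ u ∈ badClassK₁₃ θ K₀ g₀ kr (fun _ u => ∀ y : SiteSeqKey F (K₀ + K), u = ⟨K, y⟩ →
          (↑S : Set (Site (F.P (K₀ + K)) (lv K j))) ⊆ iterBlockOf (lv K j) '' (y.2 j)ᶜ) K t, weightAK₁₃ θ hP K₀ g₀ os kr K t u)
    (hCB : ∀ (K : ℕ) (t : ℝ), |t| ≤ 1 → ∀ j ∈ Finset.Icc 1 (jcut K), ∀ (S : Finset (Site (F.P (K₀ + K)) (lv K j))) (b : Site (F.P (K₀ + K)) (lv K j)),
      b ∉ S → (∀ s ∈ S, ¬ SupNear (ϱ K j) b s) →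
      ∑ u ∈ badClassK₁₃ θ K₀ g₀ kr (fun _ u => ∀ y : SiteSeqKey F (K₀ + K), u = ⟨K, y⟩ →
          (↑(insert b S) : Set (Site (F.P (K₀ + K)) (lv K j))) ⊆ iterBlockOf (lv K j) '' (y.2 j)ᶜ) K t, weightBK₁₃ θ hP K₀ g₀ os kr K t u ≤
        η K j * ∑ u ∈ badClassK₁₃ θ K₀ g₀ kr (fun _ u => ∀ y : SiteSeqKey F (K₀ + K), u = ⟨K, y⟩ →
          (↑S : Set (Site (F.P (K₀ + K)) (lv K j))) ⊆ iterBlockOf (lv K j) '' (y.2 j)ᶜ) K t, weightBK₁₃ θ hP K₀ g₀ os kr K t u) :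
    RelWeightBound 1 (classSetK₁₃ θ K₀ g₀ kr) (weightAK₁₃ θ hP K₀ g₀ os kr) (weightBK₁₃ θ hP K₀ g₀ os kr)
      (badClassK₁₃ θ K₀ g₀ kr (badKeyReadingOfBigComponent₁₃ N K₀ jcut
        (bigDialOfCard₁₃ K₀ (fun K j => (2 * ϱ K j + 1) ^ 4 * k K j * (F.L ^ 4) ^ lv K j)) F θ hP g₀ os))
      (fun K => η₀ * (1 / 2) ^ (K + 1)) :=
  relWeightBound_card_of_condBlockLetters_geometric θ hP K₀ g₀ os kr jcut (fun K j => (2 * ϱ K j + 1) ^ 4) k lv (fun K j => SupNear (ϱ K j)) hkr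
    hη0 hη1 hη₀ hD hks hlv (fun K j => supNear_refl (ϱ K j)) (fun K j => supNear_symm (ϱ K j)) (fun K j => exists_cover_supNear_four K₀ ϱ lv K j) hCA hCB

/-- ★★★ **THE N20 FACE AT THE IDENTITY KEY READING, METRIC SEPARATION, ONE-BLOCK CONDITIONAL INSIDE LETTERS, `lv K j ≤ j` — NO saturation hypothesis, NO closeness
hypothesis**: «given that the level-`j` large-field region of the class of record contains the blocks of an environment `S` every block of which is farther than `ϱ K j` from `b`
in some coordinate, containing `b`'s block as well costs at most `η K j`» (`0 ≤ η K j ≤ η₀ ≤ 1`, `2·(81·(2ϱ K j+1)^8)²·η K j ≤ 1`), in both runs, under the skeleton schedule, gives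
`RelWeightBound` at the record's carriers with `W K := η₀ · 2^{−(K+1)}`. [bookkeeping] -/
theorem relWeightBound_card_of_condInsideBlockLetters_id_supNear
    {η : ℕ → ℕ → ℝ} {η₀ : ℝ} (hη0 : ∀ K j, 0 ≤ η K j) (hη1 : ∀ K j, η K j ≤ η₀) (hη₀ : η₀ ≤ 1)
    (hD : ∀ K j, 2 * ((((2 * ϱ K j + 1) ^ 4 : ℕ) : ℝ) * 3 ^ 4 * ((2 * ϱ K j + 1) ^ 4 : ℕ)) ^ 2 * η K j ≤ 1)
    (hks : ∀ K j, Nat.clog 2 (Fintype.card (Site (F.P (K₀ + K)) (lv K j))) + K + j + 3 ≤ k K j) (hlv : ∀ K j, lv K j ≤ F.m + (K₀ + K))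
    (hlvj : ∀ K, ∀ j ∈ Finset.Icc 1 (jcut K), lv K j ≤ j)
    (hCA : ∀ (K : ℕ) (t : ℝ), |t| ≤ 1 → ∀ j ∈ Finset.Icc 1 (jcut K), ∀ (S : Finset (Site (F.P (K₀ + K)) (lv K j))) (b : Site (F.P (K₀ + K)) (lv K j)),
      b ∉ S → (∀ s ∈ S, ¬ SupNear (ϱ K j) b s) →
      ∑ u ∈ badClassK₁₃ θ K₀ g₀ (fun _ x => x) (fun _ u => ∀ y : SiteSeqKey F (K₀ + K), u = ⟨K, y⟩ →
          ∀ b' ∈ insert b S, (↑(iterBlock (lv K j) b') : Set (Site (F.P (K₀ + K)) 0)) ⊆ (y.2 j)ᶜ) K t, weightAK₁₃ θ hP K₀ g₀ os (fun _ x => x) K t u ≤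
        η K j * ∑ u ∈ badClassK₁₃ θ K₀ g₀ (fun _ x => x) (fun _ u => ∀ y : SiteSeqKey F (K₀ + K), u = ⟨K, y⟩ →
          ∀ b' ∈ S, (↑(iterBlock (lv K j) b') : Set (Site (F.P (K₀ + K)) 0)) ⊆ (y.2 j)ᶜ) K t, weightAK₁₃ θ hP K₀ g₀ os (fun _ x => x) K t u)
    (hCB : ∀ (K : ℕ) (t : ℝ), |t| ≤ 1 → ∀ j ∈ Finset.Icc 1 (jcut K), ∀ (S : Finset (Site (F.P (K₀ + K)) (lv K j))) (b : Site (F.P (K₀ + K)) (lv K j)),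
      b ∉ S → (∀ s ∈ S, ¬ SupNear (ϱ K j) b s) →
      ∑ u ∈ badClassK₁₃ θ K₀ g₀ (fun _ x => x) (fun _ u => ∀ y : SiteSeqKey F (K₀ + K), u = ⟨K, y⟩ →
          ∀ b' ∈ insert b S, (↑(iterBlock (lv K j) b') : Set (Site (F.P (K₀ + K)) 0)) ⊆ (y.2 j)ᶜ) K t, weightBK₁₃ θ hP K₀ g₀ os (fun _ x => x) K t u ≤
        η K j * ∑ u ∈ badClassK₁₃ θ K₀ g₀ (fun _ x => x) (fun _ u => ∀ y : SiteSeqKey F (K₀ + K), u = ⟨K, y⟩ →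
          ∀ b' ∈ S, (↑(iterBlock (lv K j) b') : Set (Site (F.P (K₀ + K)) 0)) ⊆ (y.2 j)ᶜ) K t, weightBK₁₃ θ hP K₀ g₀ os (fun _ x => x) K t u) :
    RelWeightBound 1 (classSetK₁₃ θ K₀ g₀ (keyReadingId₁₃ N K₀ F θ hP g₀ os)) (weightAK₁₃ θ hP K₀ g₀ os (keyReadingId₁₃ N K₀ F θ hP g₀ os))
      (weightBK₁₃ θ hP K₀ g₀ os (keyReadingId₁₃ N K₀ F θ hP g₀ os))
      (badClassK₁₃ θ K₀ g₀ (keyReadingId₁₃ N K₀ F θ hP g₀ os)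
        (badKeyReadingOfBigComponent₁₃ N K₀ jcut (bigDialOfCard₁₃ K₀ (fun K j => (2 * ϱ K j + 1) ^ 4 * k K j * (F.L ^ 4) ^ lv K j)) F θ hP g₀ os))
      (fun K => η₀ * (1 / 2) ^ (K + 1)) :=
  relWeightBound_card_of_condInsideBlockLetters_id θ K₀ g₀ lv hP os jcut (fun K j => (2 * ϱ K j + 1) ^ 4) k (fun K j => SupNear (ϱ K j))
    hη0 hη1 hη₀ hD hks hlv hlvj (fun K j => supNear_refl (ϱ K j)) (fun K j => supNear_symm (ϱ K j)) (fun K j => exists_cover_supNear_four K₀ ϱ lv K j) hCA hCB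

/-- ★★★ **… AT THE 𝐃-CUBE GRAIN, METRIC SEPARATION**: both runs' level-`j` cube sides equal `L^{lv K j}` (`1 ≤ j ≤ jcut K`), blocks = `𝐃_j`-cubes, environments farther than
`ϱ K j` cubes from `b` in some coordinate; one-block conditional INSIDE letters in both runs under the skeleton schedule give `RelWeightBound` at the record's carriers with
`W K := η₀ · 2^{−(K+1)}` — the supplier names a radius, a schedule and the letters; print's grain ([LF-II] (1.84)–(1.89)). [bookkeeping] -/
theorem relWeightBound_card_of_condInsideBlockLetters_id_of_eq_supNear
    {η : ℕ → ℕ → ℝ} {η₀ : ℝ} (hη0 : ∀ K j, 0 ≤ η K j) (hη1 : ∀ K j, η K j ≤ η₀) (hη₀ : η₀ ≤ 1)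
    (hD : ∀ K j, 2 * ((((2 * ϱ K j + 1) ^ 4 : ℕ) : ℝ) * 3 ^ 4 * ((2 * ϱ K j + 1) ^ 4 : ℕ)) ^ 2 * η K j ≤ 1)
    (hks : ∀ K j, Nat.clog 2 (Fintype.card (Site (F.P (K₀ + K)) (lv K j))) + K + j + 3 ≤ k K j) (hlv : ∀ K j, lv K j ≤ F.m + (K₀ + K))
    (hsideA : ∀ K, ∀ j ∈ Finset.Icc 1 (jcut K), dCubeSide F.L θ.τ9.M (RkOfRecord F.L θ.ν.r (histA₁₃ θ K₀ g₀ K j)) j = F.L ^ lv K j)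
    (hsideB : ∀ K, ∀ j ∈ Finset.Icc 1 (jcut K), dCubeSide F.L θ.τ9.M (RkOfRecord F.L θ.ν.r (histB₁₃ θ K₀ g₀ K (j + 1))) j = F.L ^ lv K j)
    (hCA : ∀ (K : ℕ) (t : ℝ), |t| ≤ 1 → ∀ j ∈ Finset.Icc 1 (jcut K), ∀ (S : Finset (Site (F.P (K₀ + K)) (lv K j))) (b : Site (F.P (K₀ + K)) (lv K j)),
      b ∉ S → (∀ s ∈ S, ¬ SupNear (ϱ K j) b s) →
      ∑ u ∈ badClassK₁₃ θ K₀ g₀ (fun _ x => x) (fun _ u => ∀ y : SiteSeqKey F (K₀ + K), u = ⟨K, y⟩ →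
          ∀ b' ∈ insert b S, (↑(iterBlock (lv K j) b') : Set (Site (F.P (K₀ + K)) 0)) ⊆ (y.2 j)ᶜ) K t, weightAK₁₃ θ hP K₀ g₀ os (fun _ x => x) K t u ≤
        η K j * ∑ u ∈ badClassK₁₃ θ K₀ g₀ (fun _ x => x) (fun _ u => ∀ y : SiteSeqKey F (K₀ + K), u = ⟨K, y⟩ →
          ∀ b' ∈ S, (↑(iterBlock (lv K j) b') : Set (Site (F.P (K₀ + K)) 0)) ⊆ (y.2 j)ᶜ) K t, weightAK₁₃ θ hP K₀ g₀ os (fun _ x => x) K t u)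
    (hCB : ∀ (K : ℕ) (t : ℝ), |t| ≤ 1 → ∀ j ∈ Finset.Icc 1 (jcut K), ∀ (S : Finset (Site (F.P (K₀ + K)) (lv K j))) (b : Site (F.P (K₀ + K)) (lv K j)),
      b ∉ S → (∀ s ∈ S, ¬ SupNear (ϱ K j) b s) →
      ∑ u ∈ badClassK₁₃ θ K₀ g₀ (fun _ x => x) (fun _ u => ∀ y : SiteSeqKey F (K₀ + K), u = ⟨K, y⟩ →
          ∀ b' ∈ insert b S, (↑(iterBlock (lv K j) b') : Set (Site (F.P (K₀ + K)) 0)) ⊆ (y.2 j)ᶜ) K t, weightBK₁₃ θ hP K₀ g₀ os (fun _ x => x) K t u ≤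
        η K j * ∑ u ∈ badClassK₁₃ θ K₀ g₀ (fun _ x => x) (fun _ u => ∀ y : SiteSeqKey F (K₀ + K), u = ⟨K, y⟩ →
          ∀ b' ∈ S, (↑(iterBlock (lv K j) b') : Set (Site (F.P (K₀ + K)) 0)) ⊆ (y.2 j)ᶜ) K t, weightBK₁₃ θ hP K₀ g₀ os (fun _ x => x) K t u) :
    RelWeightBound 1 (classSetK₁₃ θ K₀ g₀ (keyReadingId₁₃ N K₀ F θ hP g₀ os)) (weightAK₁₃ θ hP K₀ g₀ os (keyReadingId₁₃ N K₀ F θ hP g₀ os))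
      (weightBK₁₃ θ hP K₀ g₀ os (keyReadingId₁₃ N K₀ F θ hP g₀ os))
      (badClassK₁₃ θ K₀ g₀ (keyReadingId₁₃ N K₀ F θ hP g₀ os)
        (badKeyReadingOfBigComponent₁₃ N K₀ jcut (bigDialOfCard₁₃ K₀ (fun K j => (2 * ϱ K j + 1) ^ 4 * k K j * (F.L ^ 4) ^ lv K j)) F θ hP g₀ os))
      (fun K => η₀ * (1 / 2) ^ (K + 1)) :=
  relWeightBound_card_of_condInsideBlockLetters_id_of_eq θ K₀ g₀ lv hP os jcut (fun K j => (2 * ϱ K j + 1) ^ 4) k (fun K j => SupNear (ϱ K j))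
    hη0 hη1 hη₀ hD hks hlv hsideA hsideB (fun K j => supNear_refl (ϱ K j)) (fun K j => supNear_symm (ϱ K j)) (fun K j => exists_cover_supNear_four K₀ ϱ lv K j)
    hCA hCB

end Near

end YMDAG.UVSplit

end
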